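import Summits.CriticalPhenomena.PercolationContinuityZ3.Theorems.Transplant.Slab111SKDefs
import HarnessLib

/-!
# Diamond film `D_4` — the KERNEL CHECKER for `ShapedLinkageX 4 (DiamondFilm.sqShadow (k := 4))`: a bitboard model of the lift of `sqBall z 5` (gen-42 PROTOTYPE)

builds on p205010 (kernel theorem, internal audit signed; external expert review pending) — NOT used in this file.  Lane `prim-bschramm`, seat `prim-bschramm-p2` (gen 42; class C1b;
memo `HOME/bschramm/P2-LATTICES.md` §150); helper file (`--supports stmt-CriticalPhenomena-4575 --as helper`).
«TriFilmSKDefs» for the square shadow of `D_4` (§150 (1)–(2)): a vertex over the column `z + (a − 5, b − 5)`, `a, b ∈ [0, 10]`, is the bit `i = 144·t + 12·a + b` (stride `12`, `b = 11` a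
guard column), tag `t = 1` only over (even, even) columns (the height-`4`, vertical-strand vertex), `t = 0` the other vertex (height `0` over (e,e) columns, the unique vertex
elsewhere); column parity is absolute, `(z₀ + a − 5, z₁ + b − 5)`, hence the centre class `(c₀, c₁) = z mod 2` in the context.  Bonds: horizontal between tag-`0` vertices of
horizontally adjacent columns, vertical between the vertical-capable vertices (tag `0` off (e,e), tag `1` over (e,e)) of vertically adjacent columns.  Exact Python twin:
`HOME/prim-bschramm-p2-g42/cert/kern_d4.py` (plans by `gen_d4.py`).  Layout-free parts from «Slab111SKDefs».  The need mask includes the EXIT FILTER of `TerminalsX`.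
[cite: DuminilCopinSidoraviciusTassion2016, §2.3 (proof of Fact 2: the three disjoint paths in B_R(z))] [cite: ConwaySloane1999, Ch. 4 §7.3]
-/

namespace Summit.CriticalPhenomena.PercolationContinuityZ3.Theorems.Transplant

namespace DiamondFilm.SK

open Slab111.SK (bitOf sdiff lowIdx maskOfList endsOK maskBelow orFold rd rdMask)

/-! ## §1 Digits, the context, adjacency -/

/-- Tag digit. [folklore] -/
def dT (i : ℕ) : ℕ := i / 144
/-- First column digit (`a`, offset `a − 5`). [folklore] -/
def dA (i : ℕ) : ℕ := (i % 144) / 12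
/-- Second column digit (`b`, offset `b − 5`). [folklore] -/
def dB (i : ℕ) : ℕ := i % 12

/-- **A case**: centre class `(c₀, c₁) = z mod 2`; rerouting-block clip `tR ∈ [0,4]` (`4` = none); `tD ∈ [0,5]` (cleared-block clip `min tD 4`, window `a ≤ 5 + tD`, `5` = none);
`sR ∈ [0,5]` (rerouting-block clip `min sR 4`, `γ`-window `b ≤ 5 + sR`); `sD ∈ [0,5]` (cleared-block clip `min sD 4`, exit window `b ≤ 5 + sD`); the cleared mask `W`. [folklore] -/
structure Ctx where
  /-- centre class, first coordinate -/
  c0 : ℕ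
  /-- centre class, second coordinate -/
  c1 : ℕ
  /-- rerouting-block clip in `a` -/
  tR : ℕ
  /-- cleared-block clip / window in `a` -/
  tD : ℕ
  /-- rerouting-block clip / `γ`-window in `b` -/
  sR : ℕ
  /-- cleared-block clip / exit window in `b` -/
  sD : ℕ
  /-- the cleared vertex mask -/
  W : ℕ

/-- The column of `i` is (even, even). [folklore] -/
def Ctx.eeB (C : Ctx) (i : ℕ) : Bool := ((C.c0 + dA i + 1) % 2 == 0) && ((C.c1 + dB i + 1) % 2 == 0)

/-- An index is a vertex of `D_4` over `sqBall z 5`. [folklore] -/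
def Ctx.validB (C : Ctx) (i : ℕ) : Bool := decide (i < 288) && decide (dA i ≤ 10) && decide (dB i ≤ 10) && ((dT i == 0) || C.eeB i)

/-- Vertical-capable vertices: tag `1` over (e,e) columns, tag `0` elsewhere. [folklore] -/
def Ctx.vcapB (C : Ctx) (i : ℕ) : Bool := C.validB i && (bif C.eeB i then dT i == 1 else dT i == 0)

/-- **Index adjacency** (the bonds of `D_4`). [cite: ConwaySloane1999, Ch. 4 §7.3] -/
def Ctx.adjB (C : Ctx) (i j : ℕ) : Bool :=
  C.validB i && C.validB j &&
    (((dT i == 0) && (dT j == 0) && (dB i == dB j) && ((dA i == dA j + 1) || (dA j == dA i + 1))) ||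
      ((dA i == dA j) && ((dB i == dB j + 1) || (dB j == dB i + 1)) && C.vcapB i && C.vcapB j))

/-- The universe mask. [folklore] -/
def Ctx.univ (C : Ctx) : ℕ := maskBelow C.validB 288
/-- Tag-`0` universe vertices. [folklore] -/
def Ctx.T0 (C : Ctx) : ℕ := maskBelow (fun i => C.validB i && (dT i == 0)) 288
/-- Vertical-capable tag-`0` vertices (off the (e,e) columns). [folklore] -/
def Ctx.VX (C : Ctx) : ℕ := maskBelow (fun i => C.validB i && (dT i == 0) && !C.eeB i) 288
/-- (e,e) columns, as tag-`0` indices. [folklore] -/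
def Ctx.EEcol (C : Ctx) : ℕ := maskBelow (fun i => decide (i < 144) && C.validB i && C.eeB i) 288
/-- Non-(e,e) columns, as tag-`0` indices. [folklore] -/
def Ctx.NEcol (C : Ctx) : ℕ := maskBelow (fun i => decide (i < 144) && C.validB i && !C.eeB i) 288

/-- **The neighbourhood of a vertex set** inside the universe: horizontal shifts among tag-`0` vertices, vertical shifts among vertical-capable ones (re-tagged). [folklore] -/
def Ctx.nbh (C : Ctx) (m : ℕ) : ℕ :=
  let m0 := m &&& C.T0
  let h := ((m0 <<< 12) ||| (m0 >>> 12)) &&& C.T0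
  let mv := (m &&& C.VX) ||| ((m >>> 144) &&& C.EEcol)
  let tg := (mv <<< 1) ||| (mv >>> 1)
  let v := (tg &&& C.NEcol) ||| ((tg &&& C.EEcol) <<< 144)
  (h ||| v) &&& C.univ

/-- Iterated neighbourhood inside `region` (fuel-bounded, stops at the fixpoint). [folklore] -/
def Ctx.reachGo (C : Ctx) (region : ℕ) : ℕ → ℕ → ℕ
  | 0, cur => cur
  | f + 1, cur => let nxt := (cur ||| C.nbh cur) &&& region; bif nxt == cur then cur else C.reachGo region f nxt

/-- **All vertices reachable from `src ∩ region` by steps inside `region`.** [folklore] -/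
def Ctx.reach (C : Ctx) (region src : ℕ) : ℕ := C.reachGo region 300 (src &&& region)

/-- BFS layers from the last layer outward inside `reg`, until the layer containing `s` (fuel-bounded). [folklore] -/
def Ctx.layersGo (C : Ctx) (reg s : ℕ) : ℕ → List ℕ → ℕ → Option (List ℕ)
  | 0, _, _ => none
  | f + 1, layers, vis =>
    match layers with
    | [] => none
    | cur :: _ =>
      let nxt := sdiff (C.nbh cur &&& reg) vis
      bif nxt == 0 then none else bif Nat.testBit nxt s then some (nxt :: layers) else C.layersGo reg s f (nxt :: layers) (vis ||| nxt)

/-- Walking down the BFS layers from `cur`, always to the lowest-index neighbour in the next layer. [folklore] -/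
def Ctx.walkDown (C : Ctx) : List ℕ → ℕ → List ℕ
  | [], cur => [cur]
  | L :: rest, cur => cur :: C.walkDown rest (lowIdx (C.nbh (bitOf cur) &&& L))

/-- **The canonical shortest path from `s` to `t`** with all other vertices in `reg`. [folklore] -/
def Ctx.bfsPath (C : Ctx) (reg s t : ℕ) : Option (List ℕ) :=
  bif s == t then some [s] else
    match C.layersGo (reg ||| bitOf s ||| bitOf t) s 90 [bitOf t] (bitOf t) with
    | some (_ :: rest) => some (C.walkDown rest s)
    | _ => none

/-- Re-validation of an index path. [folklore] -/
def Ctx.pathOK (C : Ctx) (reg : ℕ) : List ℕ → ℕ → Bool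
  | [], _ => true
  | [i], seen => Nat.testBit reg i && !Nat.testBit seen i
  | i :: j :: rest, seen => Nat.testBit reg i && !Nat.testBit seen i && C.adjB i j && C.pathOK reg (j :: rest) (seen ||| bitOf i)

/-! ## §2 Blocks, windows, columns -/

/-- Over the clipped block `sqBlkR 4 z t s` (block coordinates `1 ≤ a, b ≤ 9`, `a ≤ 5 + t`, `b ≤ 5 + s`). [folklore] -/
def Ctx.inBlkB (C : Ctx) (t s i : ℕ) : Bool := C.validB i && decide (1 ≤ dA i) && decide (dA i ≤ 9) && decide (1 ≤ dB i) && decide (dB i ≤ 9) && decide (dA i ≤ 5 + t) && decide (dB i ≤ 5 + s)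
/-- Over the rerouting block. [folklore] -/
def Ctx.inRB (C : Ctx) (i : ℕ) : Bool := C.inBlkB C.tR (min C.sR 4) i
/-- Over the cleared block. [folklore] -/
def Ctx.inDB (C : Ctx) (i : ℕ) : Bool := C.inBlkB (min C.tD 4) (min C.sD 4) i
/-- `γ`-window test (`InWin z tD sR`). [folklore] -/
def Ctx.inWinB (C : Ctx) (i : ℕ) : Bool := C.validB i && decide (dA i ≤ 5 + C.tD) && decide (dB i ≤ 5 + C.sR)
/-- Exit-window test (`InWin z tD sD`). [folklore] -/
def Ctx.inWinDB (C : Ctx) (i : ℕ) : Bool := C.validB i && decide (dA i ≤ 5 + C.tD) && decide (dB i ≤ 5 + C.sD)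
/-- Centre-column test. [folklore] -/
def Ctx.cenB (C : Ctx) (i : ℕ) : Bool := C.validB i && (dA i == 5) && (dB i == 5)

/-- The rerouting mask `W ∩ \overline{sqBlkR 4 z tR sR}`. [folklore] -/
def Ctx.WR (C : Ctx) : ℕ := C.W &&& maskBelow C.inRB 288
/-- The `γ`-window mask. [folklore] -/
def Ctx.win (C : Ctx) : ℕ := maskBelow C.inWinB 288
/-- The exit-window mask. [folklore] -/
def Ctx.winD (C : Ctx) : ℕ := maskBelow C.inWinDB 288
/-- The centre-column mask. [folklore] -/
def Ctx.cen (C : Ctx) : ℕ := maskBelow C.cenB 288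
/-- The column mask of an index (both tags of its column, within the universe). [folklore] -/
def Ctx.colM (C : Ctx) (i : ℕ) : ℕ := (bitOf (i % 144) ||| bitOf (i % 144 + 144)) &&& C.univ

/-- The list of universe neighbours of an index. [folklore] -/
def Ctx.nbrList (C : Ctx) (e : ℕ) : List ℕ :=
  [e + 12, e - 12, e + 1, e - 1, e + 145, e + 143, e - 143, e - 145].filter fun j => C.adjB e j

/-! ## §3 The certified-terminal filter (with the exit property) -/

/-- Outside neighbours: `γ`-window vertices adjacent to `e` not in `W`. [folklore] -/
def Ctx.outs (C : Ctx) (e : ℕ) : List ℕ := (C.nbrList e).filter fun j => Nat.testBit C.win j && !Nat.testBit C.W j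
/-- `γ`-window neighbours of `e`. [folklore] -/
def Ctx.ins (C : Ctx) (e : ℕ) : List ℕ := (C.nbrList e).filter fun j => Nat.testBit C.win j

/-- The distinctness clauses of `Terminals.nbrs`. [folklore] -/
def Ctx.quadOK (C : Ctx) (e1 e2 o1 a1 o2 a2 : ℕ) : Bool :=
  (a1 != o1) && (a1 != e2) && (o2 != o1) && (o2 != a1) && (a2 != o2) && (a2 != e1) && (a2 != o1) && ((a1 != a2) || Nat.testBit C.cen a1)

/-- **The exit filter** (`TerminalsX.w'x`): `w` has a neighbour outside `W`, inside the exit window, off the columns of the centre, `e₁`, `e₂`. [folklore] -/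
def Ctx.exitOK (C : Ctx) (e1 e2 w : ℕ) : Bool :=
  (C.nbrList w).any fun x => !Nat.testBit C.W x && Nat.testBit C.winD x && ((C.colM x &&& (C.cen ||| C.colM e1 ||| C.colM e2)) == 0)

/-- **The need mask of an ordered terminal pair**: all `w'` for which `(E₁, E₂, w')` passes the bitboard mirror of `TerminalsX`. [cite: DuminilCopinSidoraviciusTassion2016, §2.3 (proof of Fact 2)] -/
def Ctx.needMask (C : Ctx) (e1 e2 : ℕ) : ℕ :=
  let acc := orFold (C.outs e1) fun o1 => orFold (C.ins e1) fun a1 => orFold (C.outs e2) fun o2 => orFold (C.ins e2) fun a2 =>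
    bif C.quadOK e1 e2 o1 a1 o2 a2 then
      sdiff C.W (C.cen ||| C.colM e1 ||| C.colM e2 ||| C.colM o1 ||| C.colM a1 ||| C.colM a2 ||| C.colM o2)
    else 0
  acc &&& maskBelow (fun w => Nat.testBit acc w && C.exitOK e1 e2 w) 288

/-- **The terminal list**: rerouting vertices off the centre column with an outside neighbour. [folklore] -/
def Ctx.esList (C : Ctx) : List ℕ := (List.range 288).filter fun i => Nat.testBit C.WR i && !Nat.testBit C.cen i && !(C.outs i).isEmpty

/-! ## §4 Plans, certificates, the chunk checker -/

/-- **The cover mask of a plan** `(c₁, y, b, c₂, avoid)` for the pair `(e₁, e₂)` (as «TriFilmSKDefs».`coverOf`). [cite: DuminilCopinSidoraviciusTassion2016, §2.3 (proof of Fact 2)] -/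
def Ctx.coverOf (C : Ctx) (e1 e2 c1 y b c2 avoid : ℕ) : ℕ :=
  let u := C.univ
  let W := C.W
  let WR := C.WR
  let static := (e1 != e2) && (y != b) && (y != e1) && (b != e1) && (b != e2) && (c1 != e2) && (c2 != e2) && (y != e2) &&
    ((c1 == e1) || Nat.testBit WR c1) && ((c2 == e1) || Nat.testBit WR c2) && Nat.testBit WR y && Nat.testBit WR b && Nat.testBit W b &&
    C.adjB c1 y && C.adjB c1 b && C.adjB c2 y && C.adjB c2 b && (c1 != y) && (c1 != b) && (c2 != y) && (c2 != b) &&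
    Nat.testBit u e1 && Nat.testBit u e2 && Nat.testBit WR e1 && Nat.testBit WR e2 &&
    ((avoid &&& (bitOf e1 ||| bitOf e2 ||| bitOf c1 ||| bitOf c2 ||| bitOf y ||| bitOf b)) == 0)
  bif !static then 0 else
  let regA := sdiff WR (bitOf y ||| bitOf b ||| bitOf e2 ||| avoid)
  match C.bfsPath regA e1 c1 with
  | none => 0
  | some A =>
    let mA := maskOfList A
    let regY := sdiff WR (mA ||| bitOf b ||| avoid)
    match C.bfsPath regY y e2 with
    | none => 0
    | some Y =>
      let sp1 := mA ||| maskOfList Y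
      bif !(C.pathOK (WR ||| bitOf e1 ||| bitOf c1) A 0 && endsOK A e1 c1 && C.pathOK (sdiff (WR ||| bitOf e2) mA) Y 0 && endsOK Y y e2) then 0 else
      let good1 := C.reach (sdiff W sp1) (bitOf b)
      let oA2 := bif c2 == c1 then some A else C.bfsPath regA e1 c2
      match oA2 with
      | none => 0
      | some A2 =>
        let mA2 := maskOfList A2
        let regB := sdiff WR (mA2 ||| bitOf y ||| avoid)
        match C.bfsPath regB b e2 with
        | none => 0
        | some B =>
          let sp2 := mA2 ||| maskOfList B
          bif !(C.pathOK (WR ||| bitOf e1 ||| bitOf c2) A2 0 && endsOK A2 e1 c2 && C.pathOK (sdiff (WR ||| bitOf e2) mA2) B 0 && endsOK B b e2) then 0 else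
          let good2 := C.reach (sdiff W sp2) (bitOf y)
          good1 &&& good2

/-- Read `cnt` plans for the pair `(e₁, e₂)` and accumulate their cover masks. [folklore] -/
def Ctx.rdPlans (C : Ctx) (e1 e2 : ℕ) : ℕ → ℕ → ℕ → ℕ × ℕ
  | 0, n, acc => (acc, n)
  | cnt + 1, n, acc =>
    let p1 := rd n; let p2 := rd p1.2; let p3 := rd p2.2; let p4 := rd p3.2; let p5 := rd p4.2
    let av := rdMask p5.1 p5.2 0
    let cov := C.coverOf e1 e2 p1.1 p2.1 p3.1 p4.1 av.1
    C.rdPlans e1 e2 cnt av.2 (bif cov == 0 then acc else acc ||| cov)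

/-- Check all partners `e₂` of `e₁` against the certificate numeral `n`. [folklore] -/
def Ctx.checkRow (C : Ctx) (e1 : ℕ) : List ℕ → ℕ → Bool
  | [], _ => true
  | e2 :: rest, n =>
    bif e2 == e1 then C.checkRow e1 rest n else
    let need := C.needMask e1 e2
    bif need == 0 then C.checkRow e1 rest n else
    let p := rd n
    let r := C.rdPlans e1 e2 p.1 p.2 0
    bif sdiff need r.1 == 0 then C.checkRow e1 rest r.2 else false

/-- **The chunk checker**: the rows of the listed terminals against one certificate numeral each. [folklore] -/
def Ctx.checkEs (C : Ctx) : List ℕ → List ℕ → Bool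
  | [], _ => true
  | e1 :: rest, certs =>
    match certs with
    | [] => false
    | n :: certs' => bif C.checkRow e1 C.esList n then C.checkEs rest certs' else false

/-- The cleared-block mask (what `W` may use) and the forced core (`sqBall z 1 ∩` cleared block). [folklore] -/
def Ctx.allowedM (C : Ctx) : ℕ := maskBelow C.inDB 288
/-- The forced core. [folklore] -/
def Ctx.forcedM (C : Ctx) : ℕ := maskBelow (fun i => C.inDB i && decide (4 ≤ dA i) && decide (dA i ≤ 6) && decide (4 ≤ dB i) && decide (dB i ≤ 6)) 288
/-- The instance's mask is admissible. [folklore] -/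
def Ctx.wOK (C : Ctx) : Bool := (sdiff C.W C.allowedM == 0) && (sdiff C.forcedM C.W == 0)

end DiamondFilm.SK

end Summit.CriticalPhenomena.PercolationContinuityZ3.Theorems.Transplant
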